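import Literature.AlgebraicGeometry.GroupSchemes.CartierDualCharacterYoneda
import HarnessLib

/-!
# Characters on points are points of the Cartier dual — the homomorphism `Y ⟶ G^D` (Tate 1997 §(3.8) in Yoneda form — part 3)

Layer `Literature/AlgebraicGeometry/GroupSchemes`, namespace `Literature.AlgebraicGeometry.GroupSchemes.AffineGroupScheme`; continues part 1 ★
`CartierDualCharacterPoints` (the canonical pairing `⟪t, x⟫`, separation, adjunction) and part 2 ★ `CartierDualCharacterYoneda` (§0
`isMonHom_of_universal_pair`; §2 `exists_point_cartierDual_of_character_of`: over a fixed test ring a natural multiplicative character on points is a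
point of `G^D`).  THEOREMS ONLY (no definition, no instance, no notation, no named fact, no `sorry`, no heartbeat budget).  Cell `hodgecm-mathlib`
(D-0151), programme P6 «MOD» (crux item stmt-HodgeConjecture-24832, `--supports`), organ (σ1-a) ∕ (W1-DOCK) for the W-line
`F0_P6b_WeilCartierDuality`, stub `stub_W1` (LEAD F0P6-plan (g2) M-17v (3): «the Yoneda form is preferred — no Hopf algebra in the W1 hand»; B-p08
(g32) interface note 20:17:08Z: the geometric character family lives on locally Noetherian test schemes, whence the FINITE-test-ring form).
Count-neutral: HC_CM is proved only modulo the printed citations until rung 0 closes; nothing here is about HC.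

THE PRINT ([Tate1997FiniteFlatGroupSchemes] §(3.8) p. 145 «`G^D(S) = Hom_{S-gr}(G_S, 𝔾_{m,S})`»; [MumfordAV1970] §20 p. 184, §15 Thm. 1).  For a
commutative affine group object `G` of `SchemeOver R` with `A := Γ(G, 𝒪_G)` finite free and an AFFINE group object `Y`:
* §3 **`exists_hom_cartierDual_of_character_of`** — THE YONEDA FORM with test rings in a class `P ∋ Γ(Y), Γ(Y) ⊗ A, Γ(Y) ⊗ (A ⊗ A), Γ(Y × Y) ⊗ A`:
  a family `χ(y, x) ∈ T` on points `y ∈ Y(T)`, `x ∈ G(T)`, NATURAL in `T`, MULTIPLICATIVE and UNITAL in `x`, MULTIPLICATIVE in `y`, is `⟪y ≫ w, x⟫`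
  for a HOMOMORPHISM of group schemes `w : Y ⟶ G^D` (§2 at `S := Γ(Y)` through the universal point; `w` is a homomorphism by §0 on the universal
  pair over `Γ(Y × Y)` and separation); `hom_cartierDual_ext_of` (uniqueness); `exists_eq_specOverMap_comp_isoSpecOver_inv` (every affine point
  of `Y` factors through the universal one);
* §4 the two standard classes: ALL test rings — **`exists_hom_cartierDual_of_character`**, `hom_cartierDual_ext` — and FINITE `R`-algebras when
  `Y → Spec R` is finite — **`exists_hom_cartierDual_of_character_of_finite`**, `hom_cartierDual_ext_of_finite` (`moduleFinite_alg_tensorObj`: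
  `Γ(Y × Y)` is finite).
HOW THE W1 HAND USES IT: descent of `𝒫` along `[q] × 1` gives bimultiplicative natural units `χ(ŷ, x) = e_q(x, ŷ)` on finite test rings; §4 gives
the homomorphism `w_A : (Â[q]-realisation) ⟶ (A[q]-realisation)^D`; part 1's separation + adjunction turn `e_q(f x, ŷ) = e_q(x, f^∨ ŷ)` into the
naturality square `βd ≫ w_A = w_B ≫ β^D` and «`w ŷ = 1 ⟺ χ(ŷ, ·) ≡ 1`» into injectivity; equal ranks (★ `KernelRecognitionByRank`,
★ `isIso_of_isClosedImmersion_of_finrank_alg_eq`) give the isomorphism `Â[q] ≅ A[q]^D`.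

## References
* [Tate1997FiniteFlatGroupSchemes] J. Tate, *Finite flat group schemes*, in: Modular Forms and Fermat's Last Theorem (1997), §(3.8) p. 145.
* [MumfordAV1970] D. Mumford, *Abelian Varieties* (1970), §15 Thm. 1 (p. 143), §20 pp. 183–185.
* [GortzWedhorn2023] U. Görtz, T. Wedhorn, *Algebraic Geometry II* (2023), §(27.2), (27.2.1) (pp. 606–607).
-/

set_option autoImplicit false

-- Mathlib's `Over`/`Scheme` APIs (and the tree's `DualAlg G := WithConv (Dual R (Alg G))`) are used across semireducible wrappers (as in the ★
-- `GroupSchemes/*` files).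
set_option backward.isDefEq.respectTransparency false

universe u

open CategoryTheory CategoryTheory.Limits AlgebraicGeometry MonoidalCategory CartesianMonoidalCategory TensorProduct WithConv

noncomputable section

namespace Literature.AlgebraicGeometry.GroupSchemes

namespace AffineGroupScheme

open scoped MonObj

open Literature.AlgebraicGeometry.Motives Literature.NumberTheory.DiophantineGeometry Literature.RingTheory.HopfAlgebra

variable {R : Type u} [CommRing R]

section SpecIso

variable {H₁ H₂ H₃ : Type u} [CommRing H₁] [Algebra R H₁] [CommRing H₂] [Algebra R H₂] [CommRing H₃] [Algebra R H₃]

/-- `Spec` of a composite of `R`-algebra maps (over a commutative RING; cf. ★ `specOverMapOfAlgHom_comp` over a field).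
[cite: GortzWedhorn2023, §(27.2) (p. 606)] -/
private theorem specOverMapOfAlgHom_comp'' (ψ₁ : H₁ →ₐ[R] H₂) (ψ₂ : H₂ →ₐ[R] H₃) :
    AlgPoints.specOverMapOfAlgHom ψ₂ ≫ AlgPoints.specOverMapOfAlgHom ψ₁ = AlgPoints.specOverMapOfAlgHom (ψ₂.comp ψ₁) := by
  apply Over.OverMorphism.ext
  rw [Over.comp_left, AlgPoints.specOverMapOfAlgHom_left, AlgPoints.specOverMapOfAlgHom_left, AlgPoints.specOverMapOfAlgHom_left]
  exact (Spec.map_comp (CommRingCat.ofHom ψ₁.toRingHom) (CommRingCat.ofHom ψ₂.toRingHom)).symm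

end SpecIso

variable (G : SchemeOver R) [GrpObj G] [IsCommMonObj G] [IsAffine G.left] [Module.Free R (Alg G)] [Module.Finite R (Alg G)]

/-! ## §3 EXISTENCE AND UNIQUENESS OF THE HOMOMORPHISM `w : Y ⟶ G^D` from a bimultiplicative character on points of `Y × G` -/

section Yoneda

variable {Y : SchemeOver R} [GrpObj Y] [IsAffine Y.left]

omit [GrpObj Y] in
/-- Every point `y : Spec T → Y` of an affine `Y` is `Spec ψ ≫ (Y ≅ Spec Γ(Y))⁻¹` for an `R`-algebra map `ψ : Γ(Y) → T` (★ `isoSpecOver`, ★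
`eq_specOverMapOfAlgHom`). [cite: GortzWedhorn2023, §(27.2) (p. 606)] -/
theorem exists_eq_specOverMap_comp_isoSpecOver_inv {T : Type u} [CommRing T] [Algebra R T] (y : specOver R T ⟶ Y) :
    ∃ ψ : Alg Y →ₐ[R] T, y = AlgPoints.specOverMapOfAlgHom ψ ≫ (isoSpecOver Y).inv := by
  haveI : IsAffine (specOver R (Alg Y)).left := isAffine_specOver_left (Alg Y)
  refine ⟨(ptEquiv (specOver R (Alg Y)) T (y ≫ (isoSpecOver Y).hom)).comp (algSpecOverEquiv (Alg Y)).symm.toAlgHom, ?_⟩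
  rw [← eq_specOverMapOfAlgHom (y ≫ (isoSpecOver Y).hom), Category.assoc, Iso.hom_inv_id, Category.comp_id]

omit [GrpObj Y] in
/-- **UNIQUENESS — a morphism `Y ⟶ G^D` from an affine `Y` is determined by its pairing values `⟪y ≫ w, x⟫` on points over the class
`P ∋ Γ(Y) ⊗ Γ(G)`.** [cite: Tate1997FiniteFlatGroupSchemes, §(3.8) p. 145] -/
theorem hom_cartierDual_ext_of (P : ∀ (T : Type u) [CommRing T] [Algebra R T], Prop) (hYA : P (Alg Y ⊗[R] Alg G))
    {w₁ w₂ : Y ⟶ cartierDual G}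
    (h : ∀ ⦃T : Type u⦄ [CommRing T] [Algebra R T], P T → ∀ (y : specOver R T ⟶ Y) (x : specOver R T ⟶ G),
      cartierPairing G (y ≫ w₁) x = cartierPairing G (y ≫ w₂) x) :
    w₁ = w₂ := by
  rw [← cancel_epi (isoSpecOver Y).inv]
  refine eq_of_cartierPairing_tautPt_eq G ?_
  rw [← Category.assoc, ← Category.assoc]
  exact h hYA _ _

/-- **EXISTENCE — THE YONEDA FORM OF `G^D(S) = Hom_{S-gr}(G_S, 𝔾_{m,S})`** ([Tate1997] §(3.8)), test rings restricted to a class `P`.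
For an AFFINE group object `Y` over `R` (e.g. a realisation of `Â[q]`, or `Ker f^∨`) and a family of values `χ(y, x) ∈ T` on pairs of points
`y ∈ Y(T)`, `x ∈ G(T)` over test rings `T ∈ P`, which is NATURAL in `T` (`χ(Spec θ ≫ y, Spec θ ≫ x) = θ(χ(y, x))`), MULTIPLICATIVE and UNITAL in
`x`, and MULTIPLICATIVE in `y`: there is a HOMOMORPHISM of group schemes `w : Y ⟶ G^D` with `⟪y ≫ w, x⟫ = χ(y, x)` for all `T ∈ P` (unique by
`hom_cartierDual_ext_of`).  `P` must contain `Γ(Y)`, `Γ(Y) ⊗ A`, `Γ(Y) ⊗ (A ⊗ A)` and `Γ(Y × Y) ⊗ A` (`A = Γ(G)`) — all finite `R`-algebras when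
`Y` and `G` are finite, see `…_of_finite`.  Proof: §2 at `S := Γ(Y)` with the universal point `(Y ≅ Spec Γ(Y))⁻¹` gives `t`; `w := (Y ≅ Spec Γ(Y))
≫ t`; `w` is a homomorphism because on the universal pair of points over `Γ(Y × Y)` both `w(y₁ y₂)` and `w(y₁) w(y₂)` pair with the
tautological point of `G` to `χ(y₁, ·) χ(y₂, ·)` (§0 `isMonHom_of_universal_pair`, separation ★ `eq_of_cartierPairing_tautPt_eq`).  This is the
Cartier-side terminal step of the scheme-theoretic Weil pairing ([MumfordAV1970] §20 p. 184: `e_n(x, ŷ)` is a bimultiplicative unit on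
points; §15 Thm. 1). [cite: Tate1997FiniteFlatGroupSchemes, §(3.8) p. 145] [cite: MumfordAV1970, §15 Thm. 1 (p. 143), §20 p. 184] -/
theorem exists_hom_cartierDual_of_character_of (P : ∀ (T : Type u) [CommRing T] [Algebra R T], Prop)
    (hY : P (Alg Y)) (hYA : P (Alg Y ⊗[R] Alg G)) (hYAA : P (Alg Y ⊗[R] (Alg G ⊗[R] Alg G))) (hYYA : P (Alg (Y ⊗ Y) ⊗[R] Alg G))
    (χ : ∀ ⦃T : Type u⦄ [CommRing T] [Algebra R T], (specOver R T ⟶ Y) → (specOver R T ⟶ G) → T)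
    (hnat : ∀ ⦃T : Type u⦄ [CommRing T] [Algebra R T] ⦃T' : Type u⦄ [CommRing T'] [Algebra R T'], P T → P T' →
      ∀ (θ : T →ₐ[R] T') (y : specOver R T ⟶ Y) (x : specOver R T ⟶ G),
        χ (AlgPoints.specOverMapOfAlgHom θ ≫ y) (AlgPoints.specOverMapOfAlgHom θ ≫ x) = θ (χ y x))
    (hmulx : ∀ ⦃T : Type u⦄ [CommRing T] [Algebra R T], P T →
      ∀ (y : specOver R T ⟶ Y) (x₁ x₂ : specOver R T ⟶ G), χ y (x₁ * x₂) = χ y x₁ * χ y x₂)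
    (honex : ∀ ⦃T : Type u⦄ [CommRing T] [Algebra R T], P T → ∀ (y : specOver R T ⟶ Y), χ y 1 = 1)
    (hmuly : ∀ ⦃T : Type u⦄ [CommRing T] [Algebra R T], P T →
      ∀ (y₁ y₂ : specOver R T ⟶ Y) (x : specOver R T ⟶ G), χ (y₁ * y₂) x = χ y₁ x * χ y₂ x) :
    ∃ w : Y ⟶ cartierDual G, IsMonHom w ∧ ∀ ⦃T : Type u⦄ [CommRing T] [Algebra R T], P T →
      ∀ (y : specOver R T ⟶ Y) (x : specOver R T ⟶ G), cartierPairing G (y ≫ w) x = χ y x := by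
  let e := isoSpecOver Y
  -- the character read through the universal point `e⁻¹ : Spec Γ(Y) → Y`
  let χ' : ∀ ⦃T : Type u⦄ [CommRing T] [Algebra R T], (Alg Y →ₐ[R] T) → (specOver R T ⟶ G) → T :=
    fun T _ _ ψ x => χ (AlgPoints.specOverMapOfAlgHom ψ ≫ e.inv) x
  obtain ⟨t, ht⟩ := exists_point_cartierDual_of_character_of G P hY hYA hYAA χ'
    (fun T _ _ T' _ _ hT hT' ψ θ x => by
      change χ (AlgPoints.specOverMapOfAlgHom (θ.comp ψ) ≫ e.inv) _ = θ (χ (AlgPoints.specOverMapOfAlgHom ψ ≫ e.inv) x)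
      rw [← specOverMapOfAlgHom_comp'', Category.assoc]
      exact hnat hT hT' θ _ x)
    (fun T _ _ hT ψ x₁ x₂ => hmulx hT _ x₁ x₂) (fun T _ _ hT ψ => honex hT _)
  -- the pairing formula for `w := e ≫ t`
  have hw : ∀ ⦃T : Type u⦄ [CommRing T] [Algebra R T], P T →
      ∀ (y : specOver R T ⟶ Y) (x : specOver R T ⟶ G), cartierPairing G (y ≫ e.hom ≫ t) x = χ y x := by
    intro T _ _ hT y x
    obtain ⟨ψ, rfl⟩ := exists_eq_specOverMap_comp_isoSpecOver_inv y
    rw [Category.assoc, Iso.inv_hom_id_assoc]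
    exact ht hT ψ x
  refine ⟨e.hom ≫ t, ?_, hw⟩
  -- `w` is a homomorphism: test on the universal pair of points, read over `Spec Γ(Y × Y)`
  haveI := isAffine_tensorObj_left Y
  let e₂ := isoSpecOver (Y ⊗ Y)
  let y₁ : specOver R (Alg (Y ⊗ Y)) ⟶ Y := e₂.inv ≫ fst Y Y
  let y₂ : specOver R (Alg (Y ⊗ Y)) ⟶ Y := e₂.inv ≫ snd Y Y
  have key : (y₁ * y₂) ≫ e.hom ≫ t = (y₁ ≫ e.hom ≫ t) * (y₂ ≫ e.hom ≫ t) := by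
    refine eq_of_cartierPairing_tautPt_eq G ?_
    rw [← Category.assoc _ (y₁ * y₂), MonObj.comp_mul, hw hYYA, hmuly hYYA, ← hw hYYA, ← hw hYYA, ← cartierPairing_mul_left,
      MonObj.comp_mul]
    simp only [y₁, y₂, Category.assoc]
  refine isMonHom_of_universal_pair _ ?_
  have h12 : fst Y Y * snd Y Y = e₂.hom ≫ (y₁ * y₂) := by rw [MonObj.comp_mul, Iso.hom_inv_id_assoc, Iso.hom_inv_id_assoc]
  rw [h12, Category.assoc, key, MonObj.comp_mul]
  simp only [y₁, y₂, Category.assoc, Iso.hom_inv_id_assoc]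

end Yoneda

/-! ## §4 The two standard classes of test rings: all `R`-algebras; finite `R`-algebras -/

section Corollaries

variable {Y : SchemeOver R} [GrpObj Y] [IsAffine Y.left]

/-- **`G^D` represents characters on points (all test rings)**: a natural family `χ(y, x) ∈ T` on ALL affine points `y ∈ Y(T)`, `x ∈ G(T)`,
multiplicative and unital in `x`, multiplicative in `y`, is the pairing with a UNIQUE homomorphism `w : Y ⟶ G^D`: `⟪y ≫ w, x⟫ = χ(y, x)`.
[cite: Tate1997FiniteFlatGroupSchemes, §(3.8) p. 145] [cite: MumfordAV1970, §20 p. 184] -/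
theorem exists_hom_cartierDual_of_character
    (χ : ∀ ⦃T : Type u⦄ [CommRing T] [Algebra R T], (specOver R T ⟶ Y) → (specOver R T ⟶ G) → T)
    (hnat : ∀ ⦃T : Type u⦄ [CommRing T] [Algebra R T] ⦃T' : Type u⦄ [CommRing T'] [Algebra R T']
      (θ : T →ₐ[R] T') (y : specOver R T ⟶ Y) (x : specOver R T ⟶ G),
        χ (AlgPoints.specOverMapOfAlgHom θ ≫ y) (AlgPoints.specOverMapOfAlgHom θ ≫ x) = θ (χ y x))
    (hmulx : ∀ ⦃T : Type u⦄ [CommRing T] [Algebra R T] (y : specOver R T ⟶ Y) (x₁ x₂ : specOver R T ⟶ G),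
      χ y (x₁ * x₂) = χ y x₁ * χ y x₂)
    (honex : ∀ ⦃T : Type u⦄ [CommRing T] [Algebra R T] (y : specOver R T ⟶ Y), χ y 1 = 1)
    (hmuly : ∀ ⦃T : Type u⦄ [CommRing T] [Algebra R T] (y₁ y₂ : specOver R T ⟶ Y) (x : specOver R T ⟶ G),
      χ (y₁ * y₂) x = χ y₁ x * χ y₂ x) :
    ∃ w : Y ⟶ cartierDual G, IsMonHom w ∧ ∀ ⦃T : Type u⦄ [CommRing T] [Algebra R T] (y : specOver R T ⟶ Y) (x : specOver R T ⟶ G),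
      cartierPairing G (y ≫ w) x = χ y x := by
  obtain ⟨w, hw, h⟩ := exists_hom_cartierDual_of_character_of G (fun _ _ _ => True) trivial trivial trivial trivial χ
    (fun _ _ _ _ _ _ _ _ θ y x => hnat θ y x) (fun _ _ _ _ y x₁ x₂ => hmulx y x₁ x₂) (fun _ _ _ _ y => honex y)
    (fun _ _ _ _ y₁ y₂ x => hmuly y₁ y₂ x)
  exact ⟨w, hw, fun _ _ _ y x => h trivial y x⟩

omit [GrpObj Y] in
/-- Uniqueness for all test rings: `⟪y ≫ w₁, x⟫ = ⟪y ≫ w₂, x⟫` for all affine points forces `w₁ = w₂`.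
[cite: Tate1997FiniteFlatGroupSchemes, §(3.8) p. 145] -/
theorem hom_cartierDual_ext {w₁ w₂ : Y ⟶ cartierDual G}
    (h : ∀ ⦃T : Type u⦄ [CommRing T] [Algebra R T] (y : specOver R T ⟶ Y) (x : specOver R T ⟶ G),
      cartierPairing G (y ≫ w₁) x = cartierPairing G (y ≫ w₂) x) :
    w₁ = w₂ :=
  hom_cartierDual_ext_of G (fun _ _ _ => True) trivial fun _ _ _ _ y x => h y x

omit [GrpObj Y] [IsAffine Y.left] in
/-- `Γ(Y × Y)` is a finite `R`-module when `Y → Spec R` is finite (`Y × Y → Spec R` is finite; ★ `Alg.moduleFinite`).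
[cite: GortzWedhorn2023, §(27.2) (p. 606)] -/
theorem moduleFinite_alg_tensorObj [IsFinite Y.hom] : Module.Finite R (Alg (Y ⊗ Y)) := by
  haveI : IsFinite (Y ⊗ Y).hom := by
    rw [Over.tensorObj_hom]
    infer_instance
  exact Alg.moduleFinite (Y ⊗ Y)

/-- **`G^D` represents characters on points — FINITE test rings suffice** when `Y → Spec R` is finite (and `Γ(G)` is finite, as throughout):
a natural family `χ(y, x) ∈ T` on points over FINITE `R`-algebras `T`, multiplicative and unital in `x`, multiplicative in `y`, is the pairing with
a homomorphism `w : Y ⟶ G^D`, `⟪y ≫ w, x⟫ = χ(y, x)` for all finite `T` (unique by `hom_cartierDual_ext_of_finite`).  Over a field this is the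
form the Weil-pairing hand needs: all test schemes are finite, hence locally Noetherian (Stein). [cite: Tate1997FiniteFlatGroupSchemes, §(3.8) p. 145]
[cite: MumfordAV1970, §20 p. 184] -/
theorem exists_hom_cartierDual_of_character_of_finite [IsFinite Y.hom]
    (χ : ∀ ⦃T : Type u⦄ [CommRing T] [Algebra R T], (specOver R T ⟶ Y) → (specOver R T ⟶ G) → T)
    (hnat : ∀ ⦃T : Type u⦄ [CommRing T] [Algebra R T] ⦃T' : Type u⦄ [CommRing T'] [Algebra R T'] [Module.Finite R T] [Module.Finite R T']
      (θ : T →ₐ[R] T') (y : specOver R T ⟶ Y) (x : specOver R T ⟶ G),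
        χ (AlgPoints.specOverMapOfAlgHom θ ≫ y) (AlgPoints.specOverMapOfAlgHom θ ≫ x) = θ (χ y x))
    (hmulx : ∀ ⦃T : Type u⦄ [CommRing T] [Algebra R T] [Module.Finite R T] (y : specOver R T ⟶ Y) (x₁ x₂ : specOver R T ⟶ G),
      χ y (x₁ * x₂) = χ y x₁ * χ y x₂)
    (honex : ∀ ⦃T : Type u⦄ [CommRing T] [Algebra R T] [Module.Finite R T] (y : specOver R T ⟶ Y), χ y 1 = 1)
    (hmuly : ∀ ⦃T : Type u⦄ [CommRing T] [Algebra R T] [Module.Finite R T] (y₁ y₂ : specOver R T ⟶ Y) (x : specOver R T ⟶ G),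
      χ (y₁ * y₂) x = χ y₁ x * χ y₂ x) :
    ∃ w : Y ⟶ cartierDual G, IsMonHom w ∧ ∀ ⦃T : Type u⦄ [CommRing T] [Algebra R T] [Module.Finite R T]
      (y : specOver R T ⟶ Y) (x : specOver R T ⟶ G), cartierPairing G (y ≫ w) x = χ y x := by
  haveI : Module.Finite R (Alg Y) := Alg.moduleFinite Y
  haveI : Module.Finite R (Alg (Y ⊗ Y)) := moduleFinite_alg_tensorObj
  obtain ⟨w, hw, h⟩ := exists_hom_cartierDual_of_character_of G (fun T _ _ => Module.Finite R T) inferInstance inferInstance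
    inferInstance inferInstance χ (fun _ _ _ _ _ _ hT hT' θ y x => by haveI := hT; haveI := hT'; exact hnat θ y x)
    (fun _ _ _ hT y x₁ x₂ => by haveI := hT; exact hmulx y x₁ x₂) (fun _ _ _ hT y => by haveI := hT; exact honex y)
    (fun _ _ _ hT y₁ y₂ x => by haveI := hT; exact hmuly y₁ y₂ x)
  exact ⟨w, hw, fun _ _ _ hT y x => h hT y x⟩

omit [GrpObj Y] in
/-- Uniqueness, finite test rings: for `Y → Spec R` finite, `⟪y ≫ w₁, x⟫ = ⟪y ≫ w₂, x⟫` over all FINITE `R`-algebras forces `w₁ = w₂`.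
[cite: Tate1997FiniteFlatGroupSchemes, §(3.8) p. 145] -/
theorem hom_cartierDual_ext_of_finite [IsFinite Y.hom] {w₁ w₂ : Y ⟶ cartierDual G}
    (h : ∀ ⦃T : Type u⦄ [CommRing T] [Algebra R T] [Module.Finite R T] (y : specOver R T ⟶ Y) (x : specOver R T ⟶ G),
      cartierPairing G (y ≫ w₁) x = cartierPairing G (y ≫ w₂) x) :
    w₁ = w₂ :=
  haveI : Module.Finite R (Alg Y) := Alg.moduleFinite Y
  hom_cartierDual_ext_of G (fun T _ _ => Module.Finite R T) (inferInstance : Module.Finite R (Alg Y ⊗[R] Alg G)) fun _ _ _ hT y x => by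
    haveI := hT; exact h y x

end Corollaries

end AffineGroupScheme

end Literature.AlgebraicGeometry.GroupSchemes

end
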